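import Mathlib.LinearAlgebra.Matrix.GeneralLinearGroup.Defs
import Mathlib.LinearAlgebra.Matrix.Notation
import Mathlib.Data.ZMod.Basic
import Mathlib.Algebra.Field.ZMod
import HarnessLib

/-!
# In `GL₂(𝔽₃)`, an element normalising a subgroup of order `3` has its square in that subgroup
# (cell `b2b-bsdres`, team n1011, row T-b9 'tame tower at `3`' — §5b of the generic layer, seat p02)

HONEST FRAMING (cell `b2b-bsdres`, run/shared/lean/b2b/bsd-rank1-residual/, verbatim in every
file): the goal of the cell is to DELETE the COMBINATION-SHAPED residual classes of the
Birch–Swinnerton-Dyer formula for ALL analytic-rank `≤ 1` elliptic curves over `ℚ` — "full BSD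
formula for every rank `≤ 1` curve in class `C`" assembled STRICTLY from published theorems — so
that the rank-`≤ 1` remainder becomes exactly the CONSTRUCTION-SHAPED classes, which are TYPED
(missing-input `Prop`s), NOT attempted. This is not "finishing BSD". Research route; theorems only,
plus PRIVATE computable plumbing for the certificate (quadruple product / identity / determinant,
the Boolean certificate predicate, the entry-reading map); nothing is booked by this file.

## What this file proves (a finite certificate over all `3⁸` pairs of quadruples
`(a, b, c, d) ∈ 𝔽₃⁴` standing for `(a b; c d)`, checked by `decide` — plain kernel reduction, no
`native_decide` — then bridged to Mathlib's `GL (Fin 2) (ZMod 3)` by reading off entries, as in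
`GL2F3Lift.lean`)

* `GL2F3.sq_eq_of_normalizes` (public API; everything named `Q`/`mul`/`one`/`det`/`good`/`toQ`
  is private plumbing) — for `h, u ∈ GL₂(𝔽₃)` with `u³ = 1`, `u ≠ 1` and
  `h u h⁻¹ ∈ {1, u, u²}`: **`h² ∈ {1, u, u²}`**.  (The normaliser of a Sylow `3`-subgroup
  `U = ⟨u⟩` of `GL₂(𝔽₃)` is a Borel subgroup `B` of order `12`, and `B/U ≅ 𝔽₃ˣ × 𝔽₃ˣ` has
  exponent `2`.)  Hence `h⁶ = 1` (`pow_six_eq_one_of_normalizes`).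
* `GL2F3.sq_eq_of_normalizes_of_injective` — the same in any group with an injective
  homomorphism to `GL₂(𝔽₃)` (e.g. `Aut(E[3])` through a frame).

Use: with the tame character (`Literature/…/TameInertiaCharacterGlobalProofs.lean`: the inertia
group at a prime over `3` of `ℚ(E[3])/ℚ` has a normal Sylow `3`-subgroup with CYCLIC quotient)
this bounds an inertia image in `Aut(E[3])` whose order is divisible by `3` by `6`, i.e.
`4 ∣ e₃ ⟹ 3 ∤ e₃` (`GaloisImage/ThreeTorsionInertiaTame.lean`).

References: [Serre1972] J.-P. Serre, Invent. Math. 15 (1972) §2 (subgroups of `GL₂(𝔽_p)`).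
-/

namespace Summit.BirchSwinnertonDyer.Rank1Residual.GaloisImage.GL2F3

/-! ### The certificate on `𝔽₃⁴` -/

/-- `2 × 2` matrices over `𝔽₃` as quadruples `(a, b, c, d) ↔ (a b; c d)` (a `Fintype` with
decidable equality on which `decide` runs). [folklore] -/
private abbrev Q : Type := ZMod 3 × ZMod 3 × ZMod 3 × ZMod 3

/-- Matrix product on quadruples. [folklore] -/
private def mul (x y : Q) : Q :=
  (x.1 * y.1 + x.2.1 * y.2.2.1, x.1 * y.2.1 + x.2.1 * y.2.2.2,
    x.2.2.1 * y.1 + x.2.2.2 * y.2.2.1, x.2.2.1 * y.2.1 + x.2.2.2 * y.2.2.2)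

/-- The identity quadruple. [folklore] -/
private def one : Q := (1, 0, 0, 1)

/-- Determinant of a quadruple. [folklore] -/
private def det (x : Q) : ZMod 3 := x.1 * x.2.2.2 - x.2.1 * x.2.2.1

/-- The certificate predicate for one pair `(h, u)`: "if `det h ≠ 0`, `u³ = 1`, `u ≠ 1` and
`h u = uʲ h` for some `j ∈ {0, 1, 2}`, then `h² ∈ {1, u, u²}`", as a `Bool`. [folklore] -/
private def good (h u : Q) : Bool :=
  !(decide (det h ≠ 0) && decide (mul u (mul u u) = one) && !decide (u = one) &&
      (decide (mul h u = h) || decide (mul h u = mul u h) || decide (mul h u = mul (mul u u) h)))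
  || (decide (mul h h = one) || decide (mul h h = u) || decide (mul h h = mul u u))

set_option maxRecDepth 4000 in
/-- **The certificate**: `good` holds for all `3⁸` pairs of quadruples (kernel `decide`). [folklore] -/
private theorem good_eq_true : ∀ a b c d a' b' c' d' : ZMod 3, good (a, b, c, d) (a', b', c', d') = true := by
  decide

/-- Reading the certificate back as a proposition. [folklore] -/
private theorem of_good {h u : Q} (hg : good h u = true) (h1 : det h ≠ 0)
    (h2 : mul u (mul u u) = one) (h3 : u ≠ one)
    (h4 : mul h u = h ∨ mul h u = mul u h ∨ mul h u = mul (mul u u) h) :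
    mul h h = one ∨ mul h h = u ∨ mul h h = mul u u := by
  have e1 : decide (det h ≠ 0) = true := decide_eq_true h1
  have e2 : decide (mul u (mul u u) = one) = true := decide_eq_true h2
  have e3 : decide (u = one) = false := decide_eq_false h3
  have e4 : (decide (mul h u = h) || decide (mul h u = mul u h) ||
      decide (mul h u = mul (mul u u) h)) = true := by
    rcases h4 with h | h | h
    · rw [decide_eq_true h, Bool.true_or, Bool.true_or]
    · rw [decide_eq_true h, Bool.or_true, Bool.true_or]
    · rw [decide_eq_true h, Bool.or_true]
  unfold good at hg
  rw [e1, e2, e3, e4] at hg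
  simp only [Bool.not_false, Bool.and_self, Bool.not_true, Bool.false_or, Bool.or_eq_true,
    decide_eq_true_eq] at hg
  rcases hg with (hg | hg) | hg
  · exact Or.inl hg
  · exact Or.inr (Or.inl hg)
  · exact Or.inr (Or.inr hg)

/-- **The lemma on quadruples**: for invertible `h` and `u` of order `3`, if `h u = uʲ h` for some
`j ∈ {0, 1, 2}` then `h² ∈ {1, u, u²}`. [folklore] -/
private theorem sq_mem_of_normalizes_quad (h u : Q) (h1 : det h ≠ 0) (h2 : mul u (mul u u) = one)
    (h3 : u ≠ one) (h4 : mul h u = h ∨ mul h u = mul u h ∨ mul h u = mul (mul u u) h) :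
    mul h h = one ∨ mul h h = u ∨ mul h h = mul u u := by
  obtain ⟨a, b, c, d⟩ := h
  obtain ⟨a', b', c', d'⟩ := u
  exact of_good (good_eq_true a b c d a' b' c' d') h1 h2 h3 h4

/-! ### Bridge to `GL (Fin 2) (ZMod 3)` -/

/-- Read off the entries of an element of `GL₂(𝔽₃)`. [folklore] -/
private def toQ (g : GL (Fin 2) (ZMod 3)) : Q :=
  ((g : Matrix (Fin 2) (Fin 2) (ZMod 3)) 0 0, (g : Matrix (Fin 2) (Fin 2) (ZMod 3)) 0 1,
    (g : Matrix (Fin 2) (Fin 2) (ZMod 3)) 1 0, (g : Matrix (Fin 2) (Fin 2) (ZMod 3)) 1 1)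

/-- `toQ` is multiplicative. [folklore] -/
private theorem toQ_mul (g h : GL (Fin 2) (ZMod 3)) : toQ (g * h) = mul (toQ g) (toQ h) := by
  simp only [toQ, mul, Units.val_mul, Matrix.mul_apply, Fin.sum_univ_two]

/-- `toQ 1 = 1`. [folklore] -/
private theorem toQ_one : toQ (1 : GL (Fin 2) (ZMod 3)) = one := by
  simp [toQ, one]

/-- `toQ` is injective. [folklore] -/
private theorem toQ_injective : Function.Injective toQ := by
  intro g h hgh
  simp only [toQ, Prod.mk.injEq] at hgh
  obtain ⟨h00, h01, h10, h11⟩ := hgh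
  apply Units.ext
  ext i j
  fin_cases i <;> fin_cases j
  · exact h00
  · exact h01
  · exact h10
  · exact h11

/-- `det (toQ g) = det g ≠ 0`. [folklore] -/
private theorem det_toQ_ne_zero (g : GL (Fin 2) (ZMod 3)) : det (toQ g) ≠ 0 := by
  have h : det (toQ g) = (g : Matrix (Fin 2) (Fin 2) (ZMod 3)).det := by
    rw [Matrix.det_fin_two]; rfl
  rw [h, ← Matrix.GeneralLinearGroup.val_det_apply]
  exact (Matrix.GeneralLinearGroup.det g).ne_zero

/-- **In `GL₂(𝔽₃)`: `u³ = 1`, `u ≠ 1`, `h u h⁻¹ ∈ {1, u, u²}` ⟹ `h² ∈ {1, u, u²}`.** [folklore] -/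
theorem sq_eq_of_normalizes (h u : GL (Fin 2) (ZMod 3)) (hu3 : u ^ 3 = 1) (hu1 : u ≠ 1)
    (hconj : h * u * h⁻¹ = 1 ∨ h * u * h⁻¹ = u ∨ h * u * h⁻¹ = u ^ 2) :
    h ^ 2 = 1 ∨ h ^ 2 = u ∨ h ^ 2 = u ^ 2 := by
  have hu3' : mul (toQ u) (mul (toQ u) (toQ u)) = one := by
    rw [← toQ_mul, ← toQ_mul, ← toQ_one, ← hu3, pow_three]
  have hu1' : toQ u ≠ one := fun h1 ↦ hu1 (toQ_injective (by rw [h1, toQ_one]))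
  -- `h u = uʲ h`
  have hconj' : mul (toQ h) (toQ u) = toQ h ∨ mul (toQ h) (toQ u) = mul (toQ u) (toQ h) ∨
      mul (toQ h) (toQ u) = mul (mul (toQ u) (toQ u)) (toQ h) := by
    rcases hconj with h1 | h1 | h1
    · left
      have h2 : h * u = h := by rw [mul_inv_eq_iff_eq_mul, one_mul] at h1; exact h1
      rw [← toQ_mul, h2]
    · right; left
      have h2 : h * u = u * h := by rw [mul_inv_eq_iff_eq_mul] at h1; exact h1
      rw [← toQ_mul, ← toQ_mul, h2]
    · right; right
      have h2 : h * u = u ^ 2 * h := by rw [mul_inv_eq_iff_eq_mul] at h1; exact h1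
      rw [← toQ_mul, ← toQ_mul, ← toQ_mul, h2, pow_two]
  rcases sq_mem_of_normalizes_quad (toQ h) (toQ u) (det_toQ_ne_zero h) hu3' hu1' hconj' with
    h1 | h1 | h1
  · left
    apply toQ_injective
    rw [pow_two, toQ_mul, h1, toQ_one]
  · right; left
    apply toQ_injective
    rw [pow_two, toQ_mul, h1]
  · right; right
    apply toQ_injective
    rw [pow_two, toQ_mul, h1, pow_two, toQ_mul]

/-- Hence `h⁶ = 1` for such `h`. [folklore] -/
theorem pow_six_eq_one_of_normalizes (h u : GL (Fin 2) (ZMod 3)) (hu3 : u ^ 3 = 1)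
    (hu1 : u ≠ 1) (hconj : h * u * h⁻¹ = 1 ∨ h * u * h⁻¹ = u ∨ h * u * h⁻¹ = u ^ 2) :
    h ^ 6 = 1 := by
  have h6 : h ^ 6 = (h ^ 2) ^ 3 := by rw [← pow_mul]
  rcases sq_eq_of_normalizes h u hu3 hu1 hconj with h1 | h1 | h1
  · rw [h6, h1, one_pow]
  · rw [h6, h1, hu3]
  · rw [h6, h1, ← pow_mul, show 2 * 3 = 3 * 2 from rfl, pow_mul, hu3, one_pow]

/-- **The same in any group with an injective homomorphism to `GL₂(𝔽₃)`** (e.g. `Aut(E[3])`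
through a frame `E[3] ≅ 𝔽₃²`): `u³ = 1`, `u ≠ 1`, `h u h⁻¹ ∈ {1, u, u²}` ⟹ `h² ∈ {1, u, u²}`.
[folklore] -/
theorem sq_eq_of_normalizes_of_injective {G : Type*} [Group G] (φ : G →* GL (Fin 2) (ZMod 3))
    (hφ : Function.Injective φ) (h u : G) (hu3 : u ^ 3 = 1) (hu1 : u ≠ 1)
    (hconj : h * u * h⁻¹ = 1 ∨ h * u * h⁻¹ = u ∨ h * u * h⁻¹ = u ^ 2) :
    h ^ 2 = 1 ∨ h ^ 2 = u ∨ h ^ 2 = u ^ 2 := by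
  have hu3' : φ u ^ 3 = 1 := by rw [← map_pow, hu3, map_one]
  have hu1' : φ u ≠ 1 := fun h1 ↦ hu1 (hφ (by rw [h1, map_one]))
  have hconj' : φ h * φ u * (φ h)⁻¹ = 1 ∨ φ h * φ u * (φ h)⁻¹ = φ u ∨
      φ h * φ u * (φ h)⁻¹ = φ u ^ 2 := by
    rw [← map_mul, ← map_inv, ← map_mul, ← map_pow, ← map_one φ]
    rcases hconj with h1 | h1 | h1
    · exact Or.inl (congrArg φ h1)
    · exact Or.inr (Or.inl (congrArg φ h1))
    · exact Or.inr (Or.inr (congrArg φ h1))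
  rcases sq_eq_of_normalizes (φ h) (φ u) hu3' hu1' hconj' with h1 | h1 | h1
  · exact Or.inl (hφ (by rw [map_pow, h1, map_one]))
  · exact Or.inr (Or.inl (hφ (by rw [map_pow, h1])))
  · exact Or.inr (Or.inr (hφ (by rw [map_pow, h1, map_pow])))

end Summit.BirchSwinnertonDyer.Rank1Residual.GaloisImage.GL2F3
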